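/-
Copyright (c) 2026 the pub-hodgecm-mathlib formalisation cell (harness21).  Prover seat hodgecm-mathlib-R90-C131-p05 (g0), HCML SLAB R90-TF,
section S4 «Ch. 13.1–2» (dealer K2E2-plan (g6)), ROAD «KEYS2-ANALYTIC» (MEMO `R90/R90-C131-p05/g0/MEMO-KEYS2-analytic-road.v1.md`), brick (ζ)
FILE A «ANNULUS DOCK @ N = 2».  2026-09-04/05.
-/
import Summits.HodgeConjecture.HodgeConjecture.Theorems.R90S4Keys2AnnulusVanishing          -- ★ (this seat) (ε2) FILE C: the head; brings ★ (ε1), ★ (ε2) A∕B, ★ TorusConjBall §2, norm balls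
import Summits.HodgeConjecture.HodgeConjecture.Theorems.F0P3cStCharTSCellFunAnnulusFormula    -- ★ B5 GENERIC «CELL-FUNCTION ANNULUS FORMULA» `integral_cellFun_sub_eq_smul_sub_setIntegral`
import Summits.HodgeConjecture.HodgeConjecture.Theorems.F0P3cStCharTSKeys3AnnulusDock         -- ★ (N = 3 twin) GENERIC `toFun_one_sub_smul_normalizedInd` (`g₀(m)(1) = 0`)
import Literature.NumberTheory.Automorphic.CMBorelWeylTorusConjugateTwo                      -- ★ W2-a: `weylConj_mem_cmBorel_two`, `proj_cmBorel_weylConj_two`, `torusCharPair_cm_weylConj_two`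
import HarnessLib

/-!
# R90-TF · S4 — ROAD «KEYS2-ANALYTIC», brick (ζ) FILE A «ANNULUS DOCK ON `U(Φ₂)(L⁺_v)`»: the cell integral of the Jacquet test vector
# `g₀(m) = δ^{-1/2}(m)·(m·f) − χ(m)·f` is `χ(m)·(∫_{K_{A/‖d₀‖²}} F − ∫_{K_A} F)`, hence **VANISHES** at the l.d.s. point (`wχ = χ`, `χ₁|F_v^× = ω`) for every `m ∈ T₂`

Cell `hodgecm-mathlib`, crux H413 (`stmt-HodgeConjecture-24833`, lane `--supports … --as helper`), route of record `HCCMUnconditional` (no route verbs;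
count-neutral).  Programme R90-TF, section S4 (Rogawski Ch. 13.1–2, base `R90-C131`); seat R90-C131-p05 (g0).  THEOREMS ONLY (no `def`, no instance,
no notation, no named fact, no `sorry`); imports ★ only.  The `N = 2` twin of ★ `F0P3cStCharTSKeys3AnnulusDock` §2 + ★ `F0P3cStCharTSKeys3AnalyticHalf` §1.

THE MATHEMATICS ([Casselman1995, §6.3, Lemma 7.1.1 (a)]; [BernsteinZelevinsky1977, §5 (5.2)]; [Rogawski1990, §11.1, §12.1]).  `m = diag(d₀, d₁) ∈ T₂(L⁺_v)` normalises the
open cell: `n m = m (m⁻¹ n m)`, `μ ∘ Ad(m⁻¹)⁻¹ = ‖d₀‖ μ` (★ `map_conj_cmBorel_two_eq_unitModulusChar_smul`), `τ(ʷm) = δ^{1/2}(ʷm) wχ(m)` (★ W2-a), and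
`δ^{-1/2}(m) · δ^{1/2}(ʷm) wχ(m) · ‖d₀‖ = wχ(m)` (★ `weylScalar_eq_two`) `= χ(m)` (`wχ = χ`); `Ad(m⁻¹)` maps the norm ball `K_A = {nrm u₀₁ ≤ A}` onto `K_{A/‖d₀‖²}`
(`(m⁻¹ u m)₀₁ = d₀⁻¹ d₁ u₀₁`, `‖d₁‖ = ‖d₀‖⁻¹`).  So ★ B5 reads `∫_{N₂} g₀(m)(w₀ u) dμ = χ(m) · (∫_{K_{A/‖d₀‖²}} F − ∫_{K_A} F)` for every `A` with
`tsupport(cellFun g₀(m)) ⊆ K_A`, and ★ (ε2) FILE C «ANNULUS VANISHING» makes the bracket `0` for `A` large.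
* §1 `continuous_norm_entry_two`, `exists_subset_normBall_of_isCompact_two`, `image_conj_normBall_two`; §2 **`integral_cellFun_sub_eq_smul_sub_setIntegral_normBall_two`**;
  §3 **`integral_cellFun_testVector_eq_zero_two`** (every `m`, every section `f`, any Haar `μ`).
HONEST LABEL: HC_CM is proved only modulo the 7 printed citations (2 remaining named inputs: hLiu418 = stmt-HodgeConjecture-24832,
h413 = stmt-HodgeConjecture-24833) until rung 0 closes; organ-level computation, closes nothing by itself; count-neutral.

## References
* [Casselman1995] W. Casselman, *Introduction to the theory of admissible representations of p-adic reductive groups* (1995), §6.3, Lemma 7.1.1 (a).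
* [BernsteinZelevinsky1977] I. N. Bernstein, A. V. Zelevinsky, Ann. Sci. ÉNS 10 (1977), §2.3, §5 (5.2).
* [Rogawski1990] J. D. Rogawski, *Automorphic Representations of Unitary Groups in Three Variables*, Ann. of Math. Stud. 123 (1990), §1.10 p. 9, §11.1 p. 161, §12.1 p. 171.
* [Keys1984] D. Keys, Compositio Math. 51 (1984), §7 Thm. (1).
-/

set_option autoImplicit false
-- the mandated namespace (brief §3.4) repeats the single-problem summit's segment (`HodgeConjecture.HodgeConjecture`)
set_option linter.dupNamespace false

noncomputable section

open NumberField IsDedekindDomain MeasureTheory Topology Filter Set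
open scoped Matrix MatrixGroups NNReal ENNReal
open Literature.NumberTheory.Automorphic Literature.NumberTheory.Automorphic.UnitaryGroup
open Literature.NumberTheory.GaloisRepresentations Literature.NumberTheory.GaloisRepresentations.IsNonarchimedeanLocalField
open Summit.HodgeConjecture.HodgeConjecture.Cruxes.H413.F0P3cStCharTSLocalRingNormDictionary
open Summit.HodgeConjecture.HodgeConjecture.Cruxes.H413.F0P3cStCharTSKeys3TorusConjBall
open Summit.HodgeConjecture.HodgeConjecture.Cruxes.H413.F0P3cU2PrincipalSeriesOpenCellTorusChar

namespace Summit.HodgeConjecture.HodgeConjecture.R90.S4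

variable (L : Type) [Field L] [NumberField L] [IsCMField L] (v : HeightOneSpectrum (𝓞 ↥(maximalRealSubfield L)))
  (hns : ∀ w : PlacesOver L v, IsCMField.complexConj L • w.1 = w.1)
  (χ₁ : (LocalRing L v)ˣ →* ℂˣ) (χ₂ : ↥(normOneUnits (conjLocal L (IsCMField.complexConj L) v)) →* ℂˣ)
  (w₀ : ↥(unitaryGroupOfForm (conjLocal L (IsCMField.complexConj L) v) (cmLocalForm L 2 v)))
  (hw₀ : Units.val (w₀ : GL (Fin 2) (LocalRing L v)) = cmLocalForm L 2 v)

/-! ## §1 The norm entry, large norm balls, and the image of a norm ball under `Ad(m⁻¹)` -/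

/-- **`u ↦ nrm u₀₁` is continuous on `N₂`** (★ `continuous_prod_normAbs`). [cite: Rogawski1990, §1.10 p. 9] -/
theorem continuous_norm_entry_two :
    Continuous fun u : ↥(cmBorelTriple L 2 v).N => ((∏ w' : PlacesOver L v, normAbs (w'.1.adicCompletion L)
      ((Units.val ((u : ↥(unitaryGroupOfForm (conjLocal L (IsCMField.complexConj L) v) (cmLocalForm L 2 v))) : GL (Fin 2) (LocalRing L v)) 0 1) w') : ℝ≥0) : ℝ) := by
  have hent : Continuous fun u : ↥(cmBorelTriple L 2 v).N =>
      Units.val ((u : ↥(unitaryGroupOfForm (conjLocal L (IsCMField.complexConj L) v) (cmLocalForm L 2 v))) : GL (Fin 2) (LocalRing L v)) 0 1 :=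
    (Units.continuous_val.comp (continuous_subtype_val.comp continuous_subtype_val)).matrix_elem 0 1
  exact NNReal.continuous_coe.comp ((continuous_prod_normAbs L v).comp hent)

/-- **A compact subset of `N₂` lies in all large norm balls.** [cite: Casselman1995, §6.3] -/
theorem exists_subset_normBall_of_isCompact_two {C : Set ↥(cmBorelTriple L 2 v).N} (hC : IsCompact C) :
    ∃ A₁ : ℝ, ∀ A : ℝ, A₁ ≤ A → C ⊆ {u : ↥(cmBorelTriple L 2 v).N | ((∏ w' : PlacesOver L v, normAbs (w'.1.adicCompletion L)
      ((Units.val ((u : ↥(unitaryGroupOfForm (conjLocal L (IsCMField.complexConj L) v) (cmLocalForm L 2 v))) : GL (Fin 2) (LocalRing L v)) 0 1) w') : ℝ≥0) : ℝ) ≤ A} := by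
  obtain ⟨A₁, hA₁⟩ := (hC.image (continuous_norm_entry_two L v)).bddAbove
  exact ⟨A₁, fun A hA u hu => le_trans (hA₁ ⟨u, hu, rfl⟩) hA⟩

set_option maxHeartbeats 1600000 in
/-- **`Ad(m⁻¹)` maps the norm ball `K_A` onto `K_{A/‖d₀‖²}`** for `m = diag(d) ∈ T₂` (`(m⁻¹ u m)₀₁ = d₀⁻¹ d₁ u₀₁` ★ `umat_conj_zero_one_two`, `‖d₁‖ = ‖d₀‖⁻¹` ★
`LineRing.distribHaarChar_torus_two`; the inverse map is `Ad(m)`). [cite: Rogawski1990, §1.10 p. 9] [cite: Casselman1995, §6.3] -/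
theorem image_conj_normBall_two (m : ↥(cmBorelTriple L 2 v).M) {d : Fin 2 → (LocalRing L v)ˣ}
    (hd : glDiagonal 2 (LocalRing L v) d =
      (((m : ↥(unitaryGroupOfForm (conjLocal L (IsCMField.complexConj L) v) (cmLocalForm L 2 v))) : GL (Fin 2) (LocalRing L v)))) (A : ℝ) :
    (fun u : ↥(cmBorelTriple L 2 v).N =>
        (⟨(m : ↥(unitaryGroupOfForm (conjLocal L (IsCMField.complexConj L) v) (cmLocalForm L 2 v)))⁻¹ * u * m,
          (LineRing.torus_inv_conj_mem_unipotentU_iff (conjLocal L (IsCMField.complexConj L) v) (cmLocalForm L 2 v) m.2 _).2 u.2⟩ :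
            ↥(cmBorelTriple L 2 v).N)) ''
        {u : ↥(cmBorelTriple L 2 v).N | ((∏ w' : PlacesOver L v, normAbs (w'.1.adicCompletion L)
          ((Units.val ((u : ↥(unitaryGroupOfForm (conjLocal L (IsCMField.complexConj L) v) (cmLocalForm L 2 v))) : GL (Fin 2) (LocalRing L v)) 0 1) w') : ℝ≥0) : ℝ) ≤ A} =
      {u : ↥(cmBorelTriple L 2 v).N | ((∏ w' : PlacesOver L v, normAbs (w'.1.adicCompletion L)
        ((Units.val ((u : ↥(unitaryGroupOfForm (conjLocal L (IsCMField.complexConj L) v) (cmLocalForm L 2 v))) : GL (Fin 2) (LocalRing L v)) 0 1) w') : ℝ≥0) : ℝ) ≤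
          A / ((distribHaarChar (LocalRing L v) (d 0) : ℝ) ^ 2)} := by
  letI : MeasurableSpace (LocalRing L v) := borel _
  haveI : BorelSpace (LocalRing L v) := ⟨rfl⟩
  haveI : LocallyCompactSpace ↥(unitaryGroupOfForm (conjLocal L (IsCMField.complexConj L) v) (cmLocalForm L 2 v)) :=
    locallyCompactSpace_local (IsCMField.complexConj L) 2 _ v
  haveI : SecondCountableTopology ↥(unitaryGroupOfForm (conjLocal L (IsCMField.complexConj L) v) (cmLocalForm L 2 v)) :=
    secondCountableTopology_local (IsCMField.complexConj L) 2 _ v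
  have hσ := conjLocal_conjLocal_cm L v
  have hσc := continuous_conjLocal L (IsCMField.complexConj L) v
  have hJ := cmLocalForm_eq_over L 2 v
  have hQpos : (0 : ℝ) < (distribHaarChar (LocalRing L v) (d 0) : ℝ) := NNReal.coe_pos.2 distribHaarChar_pos
  -- the entry of the conjugate: `(m⁻¹ u m)₀₁ = (d₀⁻¹ d₁) u₀₁`, of norm `nrm u₀₁ / ‖d₀‖²`
  have hd1 : (distribHaarChar (LocalRing L v) (d 1) : ℝ) = ((distribHaarChar (LocalRing L v) (d 0) : ℝ))⁻¹ := by
    rw [LineRing.distribHaarChar_torus_two (conjLocal L (IsCMField.complexConj L) v) hσ hσc hJ m hd, NNReal.coe_inv]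
  have hscal : (distribHaarChar (LocalRing L v) ((d 0)⁻¹ * d 1) : ℝ) = (((distribHaarChar (LocalRing L v) (d 0) : ℝ)) ^ 2)⁻¹ := by
    rw [map_mul, map_inv, NNReal.coe_mul, NNReal.coe_inv, hd1, sq, mul_inv]
  have hentry : ∀ u : ↥(cmBorelTriple L 2 v).N, ((∏ w' : PlacesOver L v, normAbs (w'.1.adicCompletion L)
      ((Units.val (((⟨(m : ↥(unitaryGroupOfForm (conjLocal L (IsCMField.complexConj L) v) (cmLocalForm L 2 v)))⁻¹ * u * m,
          (LineRing.torus_inv_conj_mem_unipotentU_iff (conjLocal L (IsCMField.complexConj L) v) (cmLocalForm L 2 v) m.2 _).2 u.2⟩ :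
            ↥(cmBorelTriple L 2 v).N) : ↥(unitaryGroupOfForm (conjLocal L (IsCMField.complexConj L) v) (cmLocalForm L 2 v))) : GL (Fin 2) (LocalRing L v)) 0 1) w') : ℝ≥0) : ℝ) =
      ((∏ w' : PlacesOver L v, normAbs (w'.1.adicCompletion L)
        ((Units.val ((u : ↥(unitaryGroupOfForm (conjLocal L (IsCMField.complexConj L) v) (cmLocalForm L 2 v))) : GL (Fin 2) (LocalRing L v)) 0 1) w') : ℝ≥0) : ℝ) /
        ((distribHaarChar (LocalRing L v) (d 0) : ℝ)) ^ 2 := by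
    intro u
    have h := LineRing.umat_conj_zero_one_two (conjLocal L (IsCMField.complexConj L) v) hd (u : ↥(unitaryGroupOfForm (conjLocal L (IsCMField.complexConj L) v) (cmLocalForm L 2 v)))
    change ((∏ w' : PlacesOver L v, normAbs (w'.1.adicCompletion L)
      (((((m : ↥(unitaryGroupOfForm (conjLocal L (IsCMField.complexConj L) v) (cmLocalForm L 2 v)))⁻¹ * u * m :
        ↥(unitaryGroupOfForm (conjLocal L (IsCMField.complexConj L) v) (cmLocalForm L 2 v))) : GL (Fin 2) (LocalRing L v)) : Matrix (Fin 2) (Fin 2) (LocalRing L v)) 0 1 w') : ℝ≥0) : ℝ) = _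
    rw [h, prod_normAbs_units_mul L v, NNReal.coe_mul, hscal, div_eq_inv_mul]
  ext u'
  simp only [mem_image, mem_setOf_eq]
  constructor
  · rintro ⟨u, hu, rfl⟩
    rw [hentry u]
    exact div_le_div_of_nonneg_right hu (pow_pos hQpos 2).le
  · intro hu'
    -- the preimage `ũ = Ad(m) u′ ∈ N₂`
    have hmemN : (m : ↥(unitaryGroupOfForm (conjLocal L (IsCMField.complexConj L) v) (cmLocalForm L 2 v))) * u' * (m : ↥(unitaryGroupOfForm (conjLocal L (IsCMField.complexConj L) v) (cmLocalForm L 2 v)))⁻¹ ∈ (cmBorelTriple L 2 v).N := by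
      have h := (LineRing.torus_inv_conj_mem_unipotentU_iff (conjLocal L (IsCMField.complexConj L) v) (cmLocalForm L 2 v) (inv_mem m.2)
        (u' : ↥(unitaryGroupOfForm (conjLocal L (IsCMField.complexConj L) v) (cmLocalForm L 2 v)))).2 u'.2
      simpa only [inv_inv] using h
    have hconj : (m : ↥(unitaryGroupOfForm (conjLocal L (IsCMField.complexConj L) v) (cmLocalForm L 2 v)))⁻¹ *
        ((⟨_, hmemN⟩ : ↥(cmBorelTriple L 2 v).N) : ↥(unitaryGroupOfForm (conjLocal L (IsCMField.complexConj L) v) (cmLocalForm L 2 v))) * m =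
        (u' : ↥(unitaryGroupOfForm (conjLocal L (IsCMField.complexConj L) v) (cmLocalForm L 2 v))) := by
      change (m : ↥(unitaryGroupOfForm (conjLocal L (IsCMField.complexConj L) v) (cmLocalForm L 2 v)))⁻¹ *
        ((m : ↥(unitaryGroupOfForm (conjLocal L (IsCMField.complexConj L) v) (cmLocalForm L 2 v))) * u' * (m : ↥(unitaryGroupOfForm (conjLocal L (IsCMField.complexConj L) v) (cmLocalForm L 2 v)))⁻¹) * m = _
      group
    refine ⟨⟨_, hmemN⟩, ?_, Subtype.ext hconj⟩
    -- its norm is `‖d₀‖² · nrm u′₀₁ ≤ A`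
    have key := hentry ⟨_, hmemN⟩
    simp only [hconj] at key
    -- `key : nrm u′₀₁ = nrm ũ₀₁ / ‖d₀‖²`
    have hũ : ((∏ w' : PlacesOver L v, normAbs (w'.1.adicCompletion L)
        ((Units.val (((⟨_, hmemN⟩ : ↥(cmBorelTriple L 2 v).N) : ↥(unitaryGroupOfForm (conjLocal L (IsCMField.complexConj L) v) (cmLocalForm L 2 v))) :
          GL (Fin 2) (LocalRing L v)) 0 1) w') : ℝ≥0) : ℝ) =
        ((∏ w' : PlacesOver L v, normAbs (w'.1.adicCompletion L)
          ((Units.val ((u' : ↥(unitaryGroupOfForm (conjLocal L (IsCMField.complexConj L) v) (cmLocalForm L 2 v))) : GL (Fin 2) (LocalRing L v)) 0 1) w') : ℝ≥0) : ℝ) *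
          ((distribHaarChar (LocalRing L v) (d 0) : ℝ)) ^ 2 := by
      rw [key, div_mul_cancel₀ _ (pow_pos hQpos 2).ne']
    rw [hũ]
    exact le_trans (mul_le_mul_of_nonneg_right hu' (pow_pos hQpos 2).le) (le_of_eq (div_mul_cancel₀ A (pow_pos hQpos 2).ne'))


/-! ## §2 The annulus formula on norm balls: `∫_{N₂} g₀(m)(w₀ u) dμ = χ(m) • (∫_{K_{A/‖d₀‖²}} F − ∫_{K_A} F)` -/

section NormBall

variable [MeasurableSpace ↥(cmBorelTriple L 2 v).N] [BorelSpace ↥(cmBorelTriple L 2 v).N] (μ : Measure ↥(cmBorelTriple L 2 v).N) [μ.IsHaarMeasure]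
  (w : PlacesOver L v) (hw : IsCMField.complexConj L • w.1 = w.1)

include hw hw₀ in
set_option synthInstance.maxHeartbeats 400000 in
set_option maxHeartbeats 8000000 in
-- statement∕proof over the `SmoothInd` carrier of ★ `cmPrincipalSeries` (class of ★ N1₂ ∕ ★ B5's consumer; 8 M as the N = 3 twin)
/-- **«ANNULUS FORMULA ON NORM BALLS» ON `U(Φ₂)(L⁺_v)`.**  `wχ = χ`, `m = diag(d) ∈ T₂`, `f ∈ i((χ₁, χ₂))` any section, `μ` any Haar measure of `N₂(L⁺_v)`, `A` with
`tsupport(cellFun g₀(m)) ⊆ K_A`:  `∫_{N₂} g₀(m)(w₀ u) dμ(u) = χ(m) • ( ∫_{K_{A/‖d₀‖²}} f(w₀ u) dμ − ∫_{K_A} f(w₀ u) dμ )` — ★ B5 with `c = Ad(m⁻¹)` (`c(K_A) = K_{A/‖d₀‖²}`,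
`image_conj_normBall_two`), `κ = ‖d₀‖` (★ `map_conj_cmBorel_two_eq_unitModulusChar_smul`), `s = δ^{1/2}(ʷm)·wχ(m)` (★ W2-a), `a·s·κ = χ(m)` (★ `weylScalar_eq_two` + `wχ = χ`).
[cite: Casselman1995, §6.3, Lemma 7.1.1 (a)] [cite: BernsteinZelevinsky1977, §5 (5.2)] [cite: Keys1984, §7 Thm. (1)] -/
theorem integral_cellFun_sub_eq_smul_sub_setIntegral_normBall_two
    (hw' : weylTorusCharPair (conjLocal L (IsCMField.complexConj L) v) (cmLocalForm L 2 v) (cmLocalForm_eq_over L 2 v) 0 χ₁ χ₂ =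
      torusCharPair (conjLocal L (IsCMField.complexConj L) v) (cmLocalForm L 2 v) (cmLocalForm_eq_over L 2 v) 0 χ₁ χ₂)
    (m : ↥(cmBorelTriple L 2 v).M) {d : Fin 2 → (LocalRing L v)ˣ}
    (hd : glDiagonal 2 (LocalRing L v) d = (((m : ↥(unitaryGroupOfForm (conjLocal L (IsCMField.complexConj L) v) (cmLocalForm L 2 v)))) : GL (Fin 2) (LocalRing L v)))
    (f : haveI := locallyCompactSpace_cmBorelU L 2 v
      Representation.SmoothInd (cmBorelTriple L 2 v).P
        (Representation.twist (((Representation.trivial ℂ ↥(torusU (conjLocal L (IsCMField.complexConj L) v) (cmLocalForm L 2 v)) ℂ).twist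
          (torusCharPair (conjLocal L (IsCMField.complexConj L) v) (cmLocalForm L 2 v) (cmLocalForm_eq_over L 2 v) 0 χ₁ χ₂)).comp (cmBorelTriple L 2 v).proj) (rootDeltaChar (cmBorelTriple L 2 v).P)))
    {A : ℝ}
    (hsupp : haveI := locallyCompactSpace_cmBorelU L 2 v
      tsupport (fun u : ↥(cmBorelTriple L 2 v).N =>
        ((((rootDeltaChar (cmBorelTriple L 2 v).P (Subgroup.inclusion (cmBorelTriple L 2 v).M_le m))⁻¹ : ℂˣ) : ℂ) •
              cmPrincipalSeries L 2 v (torusCharPair (conjLocal L (IsCMField.complexConj L) v) (cmLocalForm L 2 v) (cmLocalForm_eq_over L 2 v) 0 χ₁ χ₂) (m : ↥(unitaryGroupOfForm (conjLocal L (IsCMField.complexConj L) v) (cmLocalForm L 2 v))) f -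
            (((torusCharPair (conjLocal L (IsCMField.complexConj L) v) (cmLocalForm L 2 v) (cmLocalForm_eq_over L 2 v) 0 χ₁ χ₂) m : ℂˣ) : ℂ) • f).toFun
          ((w₀ : ↥(unitaryGroupOfForm (conjLocal L (IsCMField.complexConj L) v) (cmLocalForm L 2 v))) * u)) ⊆
      {u : ↥(cmBorelTriple L 2 v).N | ((∏ w' : PlacesOver L v, normAbs (w'.1.adicCompletion L) ((Units.val ((u : ↥(unitaryGroupOfForm (conjLocal L (IsCMField.complexConj L) v) (cmLocalForm L 2 v))) : GL (Fin 2) (LocalRing L v)) 0 1) w') : ℝ≥0) : ℝ) ≤ A}) :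
    haveI := locallyCompactSpace_cmBorelU L 2 v
    ∫ u : ↥(cmBorelTriple L 2 v).N,
        ((((rootDeltaChar (cmBorelTriple L 2 v).P (Subgroup.inclusion (cmBorelTriple L 2 v).M_le m))⁻¹ : ℂˣ) : ℂ) •
              cmPrincipalSeries L 2 v (torusCharPair (conjLocal L (IsCMField.complexConj L) v) (cmLocalForm L 2 v) (cmLocalForm_eq_over L 2 v) 0 χ₁ χ₂) (m : ↥(unitaryGroupOfForm (conjLocal L (IsCMField.complexConj L) v) (cmLocalForm L 2 v))) f -
            (((torusCharPair (conjLocal L (IsCMField.complexConj L) v) (cmLocalForm L 2 v) (cmLocalForm_eq_over L 2 v) 0 χ₁ χ₂) m : ℂˣ) : ℂ) • f).toFun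
          ((w₀ : ↥(unitaryGroupOfForm (conjLocal L (IsCMField.complexConj L) v) (cmLocalForm L 2 v))) * u) ∂μ =
      (((torusCharPair (conjLocal L (IsCMField.complexConj L) v) (cmLocalForm L 2 v) (cmLocalForm_eq_over L 2 v) 0 χ₁ χ₂) m : ℂˣ) : ℂ) •
        ((∫ u in {u : ↥(cmBorelTriple L 2 v).N | ((∏ w' : PlacesOver L v, normAbs (w'.1.adicCompletion L) ((Units.val ((u : ↥(unitaryGroupOfForm (conjLocal L (IsCMField.complexConj L) v) (cmLocalForm L 2 v))) : GL (Fin 2) (LocalRing L v)) 0 1) w') : ℝ≥0) : ℝ) ≤ A / ((distribHaarChar (LocalRing L v) (d 0) : ℝ) ^ 2)},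
            f.toFun ((w₀ : ↥(unitaryGroupOfForm (conjLocal L (IsCMField.complexConj L) v) (cmLocalForm L 2 v))) * u) ∂μ) -
          ∫ u in {u : ↥(cmBorelTriple L 2 v).N | ((∏ w' : PlacesOver L v, normAbs (w'.1.adicCompletion L) ((Units.val ((u : ↥(unitaryGroupOfForm (conjLocal L (IsCMField.complexConj L) v) (cmLocalForm L 2 v))) : GL (Fin 2) (LocalRing L v)) 0 1) w') : ℝ≥0) : ℝ) ≤ A},
            f.toFun ((w₀ : ↥(unitaryGroupOfForm (conjLocal L (IsCMField.complexConj L) v) (cmLocalForm L 2 v))) * u) ∂μ) := by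
  haveI := locallyCompactSpace_cmBorelU L 2 v
  haveI : LocallyCompactSpace ↥(unitaryGroupOfForm (conjLocal L (IsCMField.complexConj L) v) (cmLocalForm L 2 v)) := locallyCompactSpace_local (IsCMField.complexConj L) 2 _ v
  haveI : SecondCountableTopology ↥(unitaryGroupOfForm (conjLocal L (IsCMField.complexConj L) v) (cmLocalForm L 2 v)) := secondCountableTopology_local (IsCMField.complexConj L) 2 _ v
  letI : MeasurableSpace (LocalRing L v) := borel _
  haveI : BorelSpace (LocalRing L v) := ⟨rfl⟩
  have hJ := cmLocalForm_eq_over L 2 v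
  -- the data of ★ B5: `ʷm ∈ B₂`, `n m = m (m⁻¹ n m)`, `μ.map (m⁻¹ · m) = ‖d₀‖ • μ`, `τ(ʷm) = δ^{1/2}(ʷm) wχ(m)`
  have hm := weylConj_mem_cmBorel_two L v w₀ hw₀ m
  have hc : ∀ n : ↥(cmBorelTriple L 2 v).N,
      (n : ↥(unitaryGroupOfForm (conjLocal L (IsCMField.complexConj L) v) (cmLocalForm L 2 v))) * (m : ↥(unitaryGroupOfForm (conjLocal L (IsCMField.complexConj L) v) (cmLocalForm L 2 v))) = (m : ↥(unitaryGroupOfForm (conjLocal L (IsCMField.complexConj L) v) (cmLocalForm L 2 v))) *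
        ((⟨(m : ↥(unitaryGroupOfForm (conjLocal L (IsCMField.complexConj L) v) (cmLocalForm L 2 v)))⁻¹ * n * m,
          (LineRing.torus_inv_conj_mem_unipotentU_iff (conjLocal L (IsCMField.complexConj L) v) (cmLocalForm L 2 v) m.2 _).2 n.2⟩ :
            ↥(cmBorelTriple L 2 v).N) : ↥(unitaryGroupOfForm (conjLocal L (IsCMField.complexConj L) v) (cmLocalForm L 2 v))) := by
    intro n
    change (n : ↥(unitaryGroupOfForm (conjLocal L (IsCMField.complexConj L) v) (cmLocalForm L 2 v))) * (m : ↥(unitaryGroupOfForm (conjLocal L (IsCMField.complexConj L) v) (cmLocalForm L 2 v))) = (m : ↥(unitaryGroupOfForm (conjLocal L (IsCMField.complexConj L) v) (cmLocalForm L 2 v))) * ((m : ↥(unitaryGroupOfForm (conjLocal L (IsCMField.complexConj L) v) (cmLocalForm L 2 v)))⁻¹ * n * m)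
    rw [← mul_assoc, ← mul_assoc, mul_inv_cancel, one_mul]
  have hcc : Continuous fun n : ↥(cmBorelTriple L 2 v).N =>
      (⟨(m : ↥(unitaryGroupOfForm (conjLocal L (IsCMField.complexConj L) v) (cmLocalForm L 2 v)))⁻¹ * n * m,
          (LineRing.torus_inv_conj_mem_unipotentU_iff (conjLocal L (IsCMField.complexConj L) v) (cmLocalForm L 2 v) m.2 _).2 n.2⟩ :
            ↥(cmBorelTriple L 2 v).N) := LineRing.continuous_conj_two (conjLocal L (IsCMField.complexConj L) v) m.2
  -- `Ad(m⁻¹)` is a homeomorphism of `N₂` (inverse `Ad(m)`), hence a measurable embedding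
  have hcinv : Continuous fun n : ↥(cmBorelTriple L 2 v).N =>
      (⟨((m : ↥(unitaryGroupOfForm (conjLocal L (IsCMField.complexConj L) v) (cmLocalForm L 2 v)))⁻¹)⁻¹ * n * (m : ↥(unitaryGroupOfForm (conjLocal L (IsCMField.complexConj L) v) (cmLocalForm L 2 v)))⁻¹,
          (LineRing.torus_inv_conj_mem_unipotentU_iff (conjLocal L (IsCMField.complexConj L) v) (cmLocalForm L 2 v) (inv_mem m.2) _).2 n.2⟩ :
            ↥(cmBorelTriple L 2 v).N) := LineRing.continuous_conj_two (conjLocal L (IsCMField.complexConj L) v) (inv_mem m.2)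
  let e : ↥(cmBorelTriple L 2 v).N ≃ₜ ↥(cmBorelTriple L 2 v).N :=
    { toFun := fun n => ⟨(m : ↥(unitaryGroupOfForm (conjLocal L (IsCMField.complexConj L) v) (cmLocalForm L 2 v)))⁻¹ * n * m,
          (LineRing.torus_inv_conj_mem_unipotentU_iff (conjLocal L (IsCMField.complexConj L) v) (cmLocalForm L 2 v) m.2 _).2 n.2⟩
      invFun := fun n => ⟨((m : ↥(unitaryGroupOfForm (conjLocal L (IsCMField.complexConj L) v) (cmLocalForm L 2 v)))⁻¹)⁻¹ * n * (m : ↥(unitaryGroupOfForm (conjLocal L (IsCMField.complexConj L) v) (cmLocalForm L 2 v)))⁻¹,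
          (LineRing.torus_inv_conj_mem_unipotentU_iff (conjLocal L (IsCMField.complexConj L) v) (cmLocalForm L 2 v) (inv_mem m.2) _).2 n.2⟩
      left_inv := fun n => Subtype.ext (by
        change ((m : ↥(unitaryGroupOfForm (conjLocal L (IsCMField.complexConj L) v) (cmLocalForm L 2 v)))⁻¹)⁻¹ * ((m : ↥(unitaryGroupOfForm (conjLocal L (IsCMField.complexConj L) v) (cmLocalForm L 2 v)))⁻¹ * n * m) * (m : ↥(unitaryGroupOfForm (conjLocal L (IsCMField.complexConj L) v) (cmLocalForm L 2 v)))⁻¹ = (n : ↥(unitaryGroupOfForm (conjLocal L (IsCMField.complexConj L) v) (cmLocalForm L 2 v)))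
        group)
      right_inv := fun n => Subtype.ext (by
        change (m : ↥(unitaryGroupOfForm (conjLocal L (IsCMField.complexConj L) v) (cmLocalForm L 2 v)))⁻¹ * (((m : ↥(unitaryGroupOfForm (conjLocal L (IsCMField.complexConj L) v) (cmLocalForm L 2 v)))⁻¹)⁻¹ * n * (m : ↥(unitaryGroupOfForm (conjLocal L (IsCMField.complexConj L) v) (cmLocalForm L 2 v)))⁻¹) * m = (n : ↥(unitaryGroupOfForm (conjLocal L (IsCMField.complexConj L) v) (cmLocalForm L 2 v)))
        group)
      continuous_toFun := hcc
      continuous_invFun := hcinv }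
  have hce : MeasurableEmbedding fun n : ↥(cmBorelTriple L 2 v).N =>
      (⟨(m : ↥(unitaryGroupOfForm (conjLocal L (IsCMField.complexConj L) v) (cmLocalForm L 2 v)))⁻¹ * n * m,
          (LineRing.torus_inv_conj_mem_unipotentU_iff (conjLocal L (IsCMField.complexConj L) v) (cmLocalForm L 2 v) m.2 _).2 n.2⟩ :
            ↥(cmBorelTriple L 2 v).N) := e.measurableEmbedding
  have hμ := map_conj_cmBorel_two_eq_unitModulusChar_smul L v m μ
  have hs : ∀ c : ℂ,
      (Representation.twist
          (((Representation.trivial ℂ ↥(torusU (conjLocal L (IsCMField.complexConj L) v) (cmLocalForm L 2 v)) ℂ).twist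
            (torusCharPair (conjLocal L (IsCMField.complexConj L) v) (cmLocalForm L 2 v) (cmLocalForm_eq_over L 2 v) 0 χ₁ χ₂)).comp (cmBorelTriple L 2 v).proj) (rootDeltaChar (cmBorelTriple L 2 v).P))
          ⟨w₀ * (m : ↥(unitaryGroupOfForm (conjLocal L (IsCMField.complexConj L) v) (cmLocalForm L 2 v))) * w₀⁻¹, hm⟩ c =
        ((((rootDeltaChar (cmBorelTriple L 2 v).P ⟨w₀ * (m : ↥(unitaryGroupOfForm (conjLocal L (IsCMField.complexConj L) v) (cmLocalForm L 2 v))) * w₀⁻¹, hm⟩ : ℂˣ) : ℂ)) *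
            (((weylTorusCharPair (conjLocal L (IsCMField.complexConj L) v) (cmLocalForm L 2 v) (cmLocalForm_eq_over L 2 v) 0 χ₁ χ₂) m : ℂˣ) : ℂ)) • c := by
    intro c
    rw [Representation.twist_apply, MonoidHom.comp_apply, Representation.twist_apply, Representation.trivial_apply,
      proj_cmBorel_weylConj_two L v w₀ hw₀ m, torusCharPair_cm_weylConj_two L v w₀ hw₀ χ₁ χ₂ m, smul_smul]
  have hθ := weylScalar_eq_two L v w₀ hw₀ χ₁ χ₂ m
  have hwm : (((weylTorusCharPair (conjLocal L (IsCMField.complexConj L) v) (cmLocalForm L 2 v) (cmLocalForm_eq_over L 2 v) 0 χ₁ χ₂) m : ℂˣ) : ℂ) = (((torusCharPair (conjLocal L (IsCMField.complexConj L) v) (cmLocalForm L 2 v) (cmLocalForm_eq_over L 2 v) 0 χ₁ χ₂) m : ℂˣ) : ℂ) := by rw [hw']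
  -- the ball `K_A` is compact and `c(K_A) = K_{A/‖d₀‖²}`
  have hK := isCompact_normBall_two L v w hw A
  have himage := image_conj_normBall_two L v m hd A
  have hent : unitModulusChar (LocalRing L v) (torusEntry (conjLocal L (IsCMField.complexConj L) v) (cmLocalForm L 2 v) 0 m) = distribHaarChar (LocalRing L v) (d 0) := by
    rw [torusEntry_eq_of_glDiagonal_eq (conjLocal L (IsCMField.complexConj L) v) (cmLocalForm L 2 v) 0 m d hd]; rfl
  -- unfold ★ `cmPrincipalSeries` to the `smoothIndRep` spelling of ★ B5
  dsimp only [UnitaryGroup.cmPrincipalSeries, UnitaryGroup.principalSeries, Representation.normalizedInd] at hsupp ⊢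
  have h5 := Cruxes.H413.F0P3cStCharTSCellFunAnnulusFormula.integral_cellFun_sub_eq_smul_sub_setIntegral (cmBorelTriple L 2 v).P
    (Representation.twist
      (((Representation.trivial ℂ ↥(torusU (conjLocal L (IsCMField.complexConj L) v) (cmLocalForm L 2 v)) ℂ).twist
        (torusCharPair (conjLocal L (IsCMField.complexConj L) v) (cmLocalForm L 2 v) (cmLocalForm_eq_over L 2 v) 0 χ₁ χ₂)).comp (cmBorelTriple L 2 v).proj) (rootDeltaChar (cmBorelTriple L 2 v).P))
    (cmBorelTriple L 2 v).N.subtype w₀ μ continuous_subtype_val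
    (m : ↥(unitaryGroupOfForm (conjLocal L (IsCMField.complexConj L) v) (cmLocalForm L 2 v))) hm _ hcc hce hc hμ hs f
    (a := (((rootDeltaChar (cmBorelTriple L 2 v).P (Subgroup.inclusion (cmBorelTriple L 2 v).M_le m))⁻¹ : ℂˣ) : ℂ))
    (b := (((torusCharPair (conjLocal L (IsCMField.complexConj L) v) (cmLocalForm L 2 v) (cmLocalForm_eq_over L 2 v) 0 χ₁ χ₂) m : ℂˣ) : ℂ)) (by linear_combination hθ + hwm) hK
    (fun u hu => hsupp (subset_tsupport _ hu))
  rw [himage] at h5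
  simpa only [Subgroup.coe_subtype] using h5

end NormBall

/-! ## §3 At the l.d.s. point the cell integral of every Jacquet test vector VANISHES -/

section Vanishing

variable [MeasurableSpace ↥(cmBorelTriple L 2 v).N] [BorelSpace ↥(cmBorelTriple L 2 v).N] (μ : Measure ↥(cmBorelTriple L 2 v).N) [μ.IsHaarMeasure]
  (w : PlacesOver L v) (hw : IsCMField.complexConj L • w.1 = w.1)

include hw hns hw₀ in
set_option synthInstance.maxHeartbeats 400000 in
set_option maxHeartbeats 8000000 in
-- statement∕proof over the `SmoothInd` carrier of ★ `cmPrincipalSeries` (class of §2)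
/-- **`∫_{N₂} g₀(m)(w₀ u) dμ(u) = 0`** at a non-split `v` for `μ` ANY Haar measure of `N₂(L⁺_v)`, EVERY `m ∈ T₂(L⁺_v)` and EVERY section `f` of `i((χ₁, χ₂))`, when
`χ₁` (continuous, `χ₂` continuous) satisfies `χ₁|F_v^× = ω_{E/F}` (`hq`; then `wχ = χ` ★ (α)): §2 «ANNULUS FORMULA ON NORM BALLS» at `A = max A₁ A₂` (`A₂`: the support
ball of the test vector, ★ `hasCompactSupport_cellFun_cmBorel_two` + ★ generic `toFun_one_sub_smul_normalizedInd`; `A₁`: the threshold of ★ (ε2) FILE C «ANNULUS VANISHING»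
at `α = d₀`), and the bracket is `0`. [cite: Keys1984, §7 Thm. (1)] [cite: Rogawski1990, §11.1 p. 161; §12.1 p. 171] [cite: Casselman1995, §6.3, Lemma 7.1.1 (a)] -/
theorem integral_cellFun_testVector_eq_zero_two
    (h₁ : Continuous fun x => ((χ₁ x : ℂˣ) : ℂ)) (hq : IsQuadraticCharExtension (conjLocal L (IsCMField.complexConj L) v) χ₁)
    (hw' : weylTorusCharPair (conjLocal L (IsCMField.complexConj L) v) (cmLocalForm L 2 v) (cmLocalForm_eq_over L 2 v) 0 χ₁ χ₂ =
      torusCharPair (conjLocal L (IsCMField.complexConj L) v) (cmLocalForm L 2 v) (cmLocalForm_eq_over L 2 v) 0 χ₁ χ₂)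
    (m : ↥(cmBorelTriple L 2 v).M)
    (f : haveI := locallyCompactSpace_cmBorelU L 2 v
      Representation.SmoothInd (cmBorelTriple L 2 v).P
        (Representation.twist (((Representation.trivial ℂ ↥(torusU (conjLocal L (IsCMField.complexConj L) v) (cmLocalForm L 2 v)) ℂ).twist
          (torusCharPair (conjLocal L (IsCMField.complexConj L) v) (cmLocalForm L 2 v) (cmLocalForm_eq_over L 2 v) 0 χ₁ χ₂)).comp (cmBorelTriple L 2 v).proj) (rootDeltaChar (cmBorelTriple L 2 v).P))) :
    haveI := locallyCompactSpace_cmBorelU L 2 v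
    ∫ u : ↥(cmBorelTriple L 2 v).N,
        ((((rootDeltaChar (cmBorelTriple L 2 v).P (Subgroup.inclusion (cmBorelTriple L 2 v).M_le m))⁻¹ : ℂˣ) : ℂ) •
              cmPrincipalSeries L 2 v (torusCharPair (conjLocal L (IsCMField.complexConj L) v) (cmLocalForm L 2 v) (cmLocalForm_eq_over L 2 v) 0 χ₁ χ₂) (m : ↥(unitaryGroupOfForm (conjLocal L (IsCMField.complexConj L) v) (cmLocalForm L 2 v))) f -
            (((torusCharPair (conjLocal L (IsCMField.complexConj L) v) (cmLocalForm L 2 v) (cmLocalForm_eq_over L 2 v) 0 χ₁ χ₂) m : ℂˣ) : ℂ) • f).toFun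
          ((w₀ : ↥(unitaryGroupOfForm (conjLocal L (IsCMField.complexConj L) v) (cmLocalForm L 2 v))) * u) ∂μ = 0 := by
  haveI := locallyCompactSpace_cmBorelU L 2 v
  obtain ⟨d, hd⟩ := m.2
  -- the support ball `K_{A₂}` of the test vector (`g₀(m)(1) = 0` ★ generic, compact support ★ `hasCompactSupport_cellFun_cmBorel_two`)
  have h0 : ((((rootDeltaChar (cmBorelTriple L 2 v).P (Subgroup.inclusion (cmBorelTriple L 2 v).M_le m))⁻¹ : ℂˣ) : ℂ) •
              cmPrincipalSeries L 2 v (torusCharPair (conjLocal L (IsCMField.complexConj L) v) (cmLocalForm L 2 v) (cmLocalForm_eq_over L 2 v) 0 χ₁ χ₂) (m : ↥(unitaryGroupOfForm (conjLocal L (IsCMField.complexConj L) v) (cmLocalForm L 2 v))) f -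
            (((torusCharPair (conjLocal L (IsCMField.complexConj L) v) (cmLocalForm L 2 v) (cmLocalForm_eq_over L 2 v) 0 χ₁ χ₂) m : ℂˣ) : ℂ) • f).toFun 1 = 0 := by
    dsimp only [UnitaryGroup.cmPrincipalSeries, UnitaryGroup.principalSeries]
    exact Cruxes.H413.F0P3cStCharTSKeys3AnnulusDock.toFun_one_sub_smul_normalizedInd (cmBorelTriple L 2 v) (torusCharPair (conjLocal L (IsCMField.complexConj L) v) (cmLocalForm L 2 v) (cmLocalForm_eq_over L 2 v) 0 χ₁ χ₂) m f
  have hcs := Cruxes.H413.F0P3bU2PrincipalSeriesJacquetRankLeTwo.hasCompactSupport_cellFun_cmBorel_two L v hns w₀ hw₀ _ _ h0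
  obtain ⟨A₂, hA₂⟩ := exists_subset_normBall_of_isCompact_two L v hcs.isCompact
  -- the threshold `A₁` of ★ (ε2) «ANNULUS VANISHING» at `α = d₀`
  obtain ⟨A₁, hA₁⟩ := exists_forall_setIntegral_normBall_sub_eq_zero_two L v w hw hns χ₁ χ₂ w₀ hw₀ h₁ hq μ (d 0) f
  rw [integral_cellFun_sub_eq_smul_sub_setIntegral_normBall_two L v χ₁ χ₂ w₀ hw₀ μ w hw hw' m hd f (hA₂ (max A₁ A₂) (le_max_right _ _)),
    hA₁ (max A₁ A₂) (le_max_left _ _), smul_zero]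

end Vanishing

end Summit.HodgeConjecture.HodgeConjecture.R90.S4

end
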